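import Summits.BirchSwinnertonDyer.BirchSwinnertonDyer.Theorems.CumulativeHeegnerLeopoldtRedSplitControlAtThreeOfR4
import Summits.BirchSwinnertonDyer.BirchSwinnertonDyer.Theorems.SchneiderFreeAdditiveX3PoitouTateReciprocityEqualityHolds
import HarnessLib

/-!
# Crux K4 `RedSplitControlAtThree` (stmt-BirchSwinnertonDyer-24200) of route `CumulativeHeegnerLeopoldt` — PROVED BY NAME

Seat `bsd-line-chl-p2` g7 (cell `bsd-wall`, width prover on K4 under the lead `bsd-line-chl-p1`; `--workitem
stmt-BirchSwinnertonDyer-24200`).  The last displayed hypothesis of `redSplitControlAtThree_of_R4` (this seat, file `…OfR4`: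
K4 ⟸ the reciprocity identity (R4) at the totally complex number fields) is cell bsd-schneider's theorem
`PoitouTateReduction.hR4_ideleProjection` (door-c5 g18, file `…SchneiderFreeAdditiveX3PoitouTateReciprocityEqualityHolds`:
THE idèle projections, `classBarInv K`, the bridge `nat = −(Φ⁻¹ ∘ H¹(κ))`, every number field).  Chain of tree theorems behind
the crux: the K1 door `redSplitControlAtThree_of_poitouTate_totallyComplex` (g5) ← PT1 `poitouTate_selmerStructure_duality_holds`
(door-c4 g18) ∧ PT2 at totally complex `K` = `poitouTate_sha_tateDual_of_R4` (this seat: (A) `tateDual_localGlobal` =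
Brauer–Hasse–Noether over `K(M)` + inf–res + Hilbert 90 + local triviality ascends + transport; door-c5's (B)
`sha_hom_units_dies_in_idele`; door-c4's `selmerComplement_canonical_holds`, `poitouTate_sha_tateDual_of_R4_A`; Tate duality for
`C̄`, THE idèle projections, (R3)) ← (R4) `hR4_ideleProjection`.

* **`redSplitControlAtThree_proof`** — its TYPE is the route decl
  `Summit.BirchSwinnertonDyer.BirchSwinnertonDyer.Theses.CumulativeHeegnerLeopoldt.RedSplitControlAtThree` verbatim; standard axioms.
* `poitouTate_sha_tateDual_totallyComplex` — PT2 `poitouTate_sha_tateDual K` for every totally complex number field `K`, recorded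
  under this road's namespace (= door-c5's `poitouTate_sha_tateDual_of_A` fed with `tateDual_localGlobal`).

HONEST FRAMING: this closes crux K4 of ONE route (Jetchev–Skinner–Wan-type anticyclotomic control at the potentially supersingular
split prime 3 on the reducible non-anomalous cell, from the route's standing hypotheses incl. Kolyvagin finiteness); BSD is NOT
proved by this file, and the route `CumulativeHeegnerLeopoldt` still has its other cruxes (K1 `CumulativeHeegnerInclusionAtThree`,
K2, K5, K6, print packages).

References: [MilneADT2006] I Thm. 4.10 and its proof (p. 58), Lemma 4.13; [CasselsFrohlichANT1967] Ch. VII §11.2 (bis);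
[PerrinRiou1987] §1.
-/

noncomputable section

open Function NumberField IsDedekindDomain CategoryTheory CategoryTheory.Abelian Field
open scoped NumberField ContRepresentation

-- `Summit.<P>.<Sub>` repeats `BirchSwinnertonDyer` by the tree's layout convention (D-0017)
set_option linter.dupNamespace false

namespace Summit.BirchSwinnertonDyer.BirchSwinnertonDyer.Theorems.RedSplitControlAtThreeOfFacts

open Literature.NumberTheory.GaloisRepresentations Literature.NumberTheory.GaloisCohomology
open Summit.BirchSwinnertonDyer.BirchSwinnertonDyer.Theorems.SchneiderFreeAdditiveX3.PoitouTateReduction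
  (hR4_ideleProjection poitouTate_sha_tateDual_of_A poitouTate_selmerStructure_duality_holds)
open Summit.BirchSwinnertonDyer.BirchSwinnertonDyer.Theorems.PoitouTateShaTwoReadout (tateDual_localGlobal)

/-- **PT2 `poitouTate_sha_tateDual K` (Milne I Thm. 4.10 (a): `Ш¹(M)` finite and dual to `Ш²(M^D)`) for every TOTALLY COMPLEX
number field `K`** — door-c5's `poitouTate_sha_tateDual_of_A` with (A) := this seat's `tateDual_localGlobal`.
[cite: MilneADT2006, Ch. I, Thm. 4.10 (a) (proof, p. 58), Lemma 4.13][cite: CasselsFrohlichANT1967, Ch. VII §11.2 (bis)] -/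
theorem poitouTate_sha_tateDual_totallyComplex (K : Type) [Field K] [NumberField K] [IsTotallyComplex K] :
    poitouTate_sha_tateDual K :=
  poitouTate_sha_tateDual_of_A fun n _ _ _ _ _ _ ρ₀ hM => tateDual_localGlobal ρ₀ n hM

/-- **Crux K4 `RedSplitControlAtThree` of route `CumulativeHeegnerLeopoldt`, BY NAME, unconditionally**: the K1 door at the
totally complex fields (`redSplitControlAtThree_of_poitouTate_totallyComplex`) fed with PT1 (`poitouTate_selmerStructure_duality_holds`,
door-c4) and PT2 (`poitouTate_sha_tateDual_totallyComplex`); equivalently `redSplitControlAtThree_of_R4` with door-c5's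
`hR4_ideleProjection`. [cite: MilneADT2006, Ch. I, Thm. 4.10 (proof, p. 58), Lemma 4.13][cite: PerrinRiou1987, §1] -/
theorem redSplitControlAtThree_proof :
    Summit.BirchSwinnertonDyer.BirchSwinnertonDyer.Theses.CumulativeHeegnerLeopoldt.RedSplitControlAtThree :=
  redSplitControlAtThree_of_poitouTate_totallyComplex (fun K _ _ _ => poitouTate_selmerStructure_duality_holds K)
    fun K _ _ _ => poitouTate_sha_tateDual_totallyComplex K

end Summit.BirchSwinnertonDyer.BirchSwinnertonDyer.Theorems.RedSplitControlAtThreeOfFacts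

end
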